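/-
Copyright (c) 2026. All rights reserved.
Released under Apache 2.0 license as described in the file LICENSE.
-/
import Summits.HodgeConjecture.HodgeConjecture.Theorems.K2E1BLBorelOperatorsU2Defs                 -- ★ p858786 leaf 2: `iotaFun`, `IotaBound`, `iota`, `coeFn_iota`, `memLp_iotaFun`
import Summits.HodgeConjecture.HodgeConjecture.Theorems.K2E1BLConstantTermProjectionMeasurableU2  -- ★ P2b′: `cnstN_toHN_eq_toHN_borelConstantTerm'` (letter `hdis'`, ★ p858957 discharges it)
import Summits.HodgeConjecture.HodgeConjecture.Theorems.K2E1BLEisensteinInWeightedSpaceU3          -- ★ p858882 (this seat): «E ⊥ 𝒞_k» `…_of_mem_cuspTestClass_cm_two` (+ FILE C, (Ξ₂)₂, dictionary)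
import Summits.HodgeConjecture.HodgeConjecture.Theorems.K2E1BLEisensteinMemHXCMTwo                -- ★ p858951 (this seat) (b1): uniform majorant `tsum_borelHeight_rpow_le_uniform_cm_two`
import Literature.NumberTheory.Automorphic.UnitaryGroupKernelDictionary                          -- ★ `quotientSubgroup_quasiSplit`
import HarnessLib

/-!
# EIS-R7-BL-SPH-2 «E_z SOLVES THE 𝔛-SYSTEM» — part 1: (S2) the constant-term equation and (S3) `Q E_z = 0`

Campaign EIS-R7-BL-SPH-2 (Bernstein–Lapid, arXiv:1911.02342, on `U(1,1) = quasiSplit L⁺ L c 2` of a CM extension), deal of K2E1-plan (g5)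
2026-09-04T09:30:05Z: the spherical Borel Eisenstein series `E_z = E(φ₀H^z)` (`1 < Re z`), as the element `toHX k μ E_z ∈ 𝓗_k(𝔛)` of ★ (b1), SOLVES the
holomorphic system of ★ G-c `K2E1BLXSystemPackage.exists_xSystem` —

  `(∀ i, T_i ψ = ĥ_i(z)•ψ) ∧ cnst_N(ι ψ) = φ₀•α₁(z) + b•α₂(z) ∧ Q ψ = 0`,  `α₁(z) = [H^z]`, `α₂(z) = [H^{1−z}]` in `𝓗_k(Z_a)`.

This file (part 1) proves the second and third equations; the first (`T_i = R(h_i)` on `𝓗_k(𝔛)`, hypothesis-first on P3-C's letter) and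
the packaged head are appended when P3-C's operator bytes land.

* §1 (generic rank, the ℓ8 compatibility): `ι (toHX φ) = toHN φ` — the pull-back `ι : 𝓗_k(𝔛) → 𝓗_k(Z_a)` of ★ leaf 2 sends the class of a
  left-`G(F)`-invariant `φ` to the class of its `Z`-lift (`quotFun φ ∘ pZX = zFun φ`), and `zFun φ ∈ L²(wtm)` comes for free from `IotaBound`.
* §2 (S2): `cnst_N (ι (toHX E_z)) = φ₀•toHN(H^z) + b•toHN(H^{1−z})` with `b` the coefficient of ★ (Ξ₂)₂
  `exists_borelConstantTerm_sphericalEisenstein_sub_eq_mul_cm_two` (`(E_z)_B = φ₀H^z + bH^{1−z}` pointwise) — §1, ★ P2b′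
  `cnstN_toHN_eq_toHN_borelConstantTerm'` (letter `hdis'`, discharged by ★ `integral_zFun_borelConstantTerm_eq_of_unfolding` under the structural
  letters), linearity of `toHN = MemLp.toLp ∘ zFun`.
* §3 (generic Hilbert space): the orthogonal projection onto the closed span of a set `𝒮` kills every vector orthogonal to `𝒮`.
* §4 (S3): `Q (toHX E_z) = 0` for `Q` the projection onto the closed span of ANY set of classes `[w₁^{2k}·φ̃]`, `φ ∈ 𝒞_k` Borel — the `𝓗_k(𝔛)`
  inner product `⟪[w₁^{2k}φ̃], [Ẽ_z]⟫ = ∫ Ẽ_z·conj φ̃ dμ` vanishes by ★ «E ⊥ 𝒞_k» `…_of_mem_cuspTestClass_cm_two`, whose finiteness letter `hX`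
  (ℓ10) is DISCHARGED here from ★ (b1)'s uniform majorant (`Σ_q |f_z(q x̃⁻¹)| ≤ |φ₀|·C·w₁(x)^k`) and `w₁^k|φ̃| ≤ |φ̃| + w₁^{2k}|φ̃| ∈ L¹(μ)`.

Count-neutral helper (supports h413 = stmt-HodgeConjecture-24833); HC_CM stays proved only modulo its printed citations.

References: [cite: BernsteinLapid2019, §4 (Claims 1–5, pp. 9–10)] (arXiv:1911.02342); [cite: MoeglinWaldspurger1995, I.2.6, II.1.5, II.1.7, IV.1.8];
[cite: Garrett2018, §1.10, §2.10].
-/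

open MeasureTheory Measure NumberField IsDedekindDomain Set Filter MulAction
open scoped ENNReal NNReal ComplexConjugate
open Literature.MeasureTheory.Group Literature.NumberTheory Literature.NumberTheory.Automorphic Literature.NumberTheory.Automorphic.UnitaryGroup AdelicGroupData
open Summit.HodgeConjecture.HodgeConjecture.Cruxes.H413.K2E1BorelEisensteinU
open Summit.HodgeConjecture.HodgeConjecture.Cruxes.H413.K2E1BLBorelSpacesU2Defs
open Summit.HodgeConjecture.HodgeConjecture.Cruxes.H413.K2E1BLBorelOperatorsU2Defs
open Summit.HodgeConjecture.HodgeConjecture.Cruxes.H413.K2E1BLConstantTermProjectionMeasurableU2 (cnstN_toHN_eq_toHN_borelConstantTerm')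
open Summit.HodgeConjecture.HodgeConjecture.Cruxes.H413.K2E1BLEisensteinInWeightedSpaceU2 (exists_borelConstantTerm_sphericalEisenstein_sub_eq_mul_cm_two)
open Summit.HodgeConjecture.HodgeConjecture.Cruxes.H413.K2E1BLEisensteinInWeightedSpaceU2Weights (supHeight_eq_ciSup_arithmetic exists_pos_forall_le_supHeight_cm)
open Summit.HodgeConjecture.HodgeConjecture.Cruxes.H413.K2E1BLEisensteinInWeightedSpaceU3 (integral_quotFun_eisensteinSeriesU_mul_conj_eq_zero_of_mem_cuspTestClass_cm_two)
open Summit.HodgeConjecture.HodgeConjecture.Cruxes.H413.K2E1BLEisensteinMemHXCMTwo (tsum_borelHeight_rpow_le_uniform_cm_two)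
open Summit.HodgeConjecture.HodgeConjecture.Cruxes.H413.K2E1BLIotaBoundU2 (measurable_supHeight)
open Summit.HodgeConjecture.HodgeConjecture.Cruxes.H413.K2E1BLIotaUnfoldingU (borelHeight_arithmeticBorel_mul')
open Summit.HodgeConjecture.HodgeConjecture.Cruxes.H413.K2E1BorelCosetsDictionary (exists_equiv_arithmeticBorelQuot apply_out_eq)
open Summit.HodgeConjecture.HodgeConjecture.Cruxes.H413.K2E1BorelEisensteinGodementCMTwo (summable_borelHeight_rpow_cm_two)
open Summit.HodgeConjecture.HodgeConjecture.Cruxes.H413.K2E1BorelEisensteinRegularU (continuous_eisensteinSeriesU_flatSectionU_cm_two)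

namespace Summit.HodgeConjecture.HodgeConjecture.Cruxes.H413.K2E1SphericalEisensteinSolvesXSystemU2

/-! ## §1 The ℓ8 compatibility `ι (toHX φ) = toHN φ` (generic rank) -/

section Compat

variable {F E : Type} [Field F] [NumberField F] [Field E] [NumberField E] [Algebra F E] {c : E ≃ₐ[F] E} {N : ℕ} [NeZero N]
variable {k : ℕ} {c₁ : ℝ≥0} {μ : Measure (quasiSplit F E c N).automorphicQuotient} {μZ : Measure (borelQuotient F E c N)}

omit [NeZero N] in
/-- `quotFun φ ∘ pZX = zFun φ` for left-`G(F)`-invariant `φ` (★ `quotFun_pZX`, ★ `zFun_toBorelQuotient`; `B(F) ≤ G(F)`). [cite: BernsteinLapid2019, §4 p. 10] -/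
theorem quotFun_pZX_eq_zFun {φ : (quasiSplit F E c N).Adelic → ℂ}
    (hφ : ∀ γ ∈ (quasiSplit F E c N).quotientSubgroup, ∀ g, φ (γ * g) = φ g) (x : borelQuotient F E c N) :
    (quasiSplit F E c N).quotFun φ (pZX F E c N x) = zFun F E c N φ x := by
  have hφB : ∀ γ ∈ ratBorelSubgroup F E c N, ∀ g, φ (γ * g) = φ g := fun γ hγ g =>
    hφ γ ((quasiSplit F E c N).arithmeticSubgroup_le_quotientSubgroup (ratBorelSubgroup_le_arithmeticSubgroup F E c N hγ)) g
  induction x using Quotient.inductionOn with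
  | h g => exact (quotFun_pZX F E c N hφ g).trans (zFun_toBorelQuotient F E c N hφB g).symm

/-- `iotaFun (toHX φ) =ᵐ zFun φ` on `(Z_a, wtm)`: the a.e. identity `⇑[φ̃] = φ̃` pulled back along the quasi-measure-preserving `pZX` (★ `IotaBound`, first clause).
[cite: BernsteinLapid2019, §4 Claim 4 p. 10] -/
theorem iotaFun_toHX_ae_eq_zFun (hb : IotaBound F E c N k c₁ μ μZ) {φ : (quasiSplit F E c N).Adelic → ℂ}
    (hφ : ∀ γ ∈ (quasiSplit F E c N).quotientSubgroup, ∀ g, φ (γ * g) = φ g)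
    (hφ2 : MemLp ((quasiSplit F E c N).quotFun φ) 2 (μ.withDensity fun x => (((supHeight F E c N x)⁻¹ ^ (2 * k) : ℝ≥0) : ℝ≥0∞))) :
    iotaFun F E c N k μ (toHX F E c N k μ φ hφ2) =ᵐ[weightedTruncMeasure F E c N k c₁ μZ] zFun F E c N φ := by
  have h2 : ((toHX F E c N k μ φ hφ2 : HX F E c N k μ) : (quasiSplit F E c N).automorphicQuotient → ℂ)
      =ᵐ[μ.withDensity fun x => (((supHeight F E c N x)⁻¹ ^ (2 * k) : ℝ≥0) : ℝ≥0∞)] (quasiSplit F E c N).quotFun φ := by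
    unfold toHX; exact hφ2.coeFn_toLp
  exact (hb.1.ae_eq h2).trans (Eventually.of_forall fun x => quotFun_pZX_eq_zFun hφ x)

/-- **`zFun φ ∈ L²(Z_a, wtm)` FOR FREE**: if `[φ̃] ∈ 𝓗_k(𝔛)` and `IotaBound` holds, the `Z`-lift `zFun φ` is in `𝓗_k(Z_a)` (★ `memLp_iotaFun` along §1's a.e. identity).
[cite: BernsteinLapid2019, §4 Claim 4 p. 10] -/
theorem memLp_zFun_of_iotaBound (hb : IotaBound F E c N k c₁ μ μZ) {φ : (quasiSplit F E c N).Adelic → ℂ}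
    (hφ : ∀ γ ∈ (quasiSplit F E c N).quotientSubgroup, ∀ g, φ (γ * g) = φ g)
    (hφ2 : MemLp ((quasiSplit F E c N).quotFun φ) 2 (μ.withDensity fun x => (((supHeight F E c N x)⁻¹ ^ (2 * k) : ℝ≥0) : ℝ≥0∞))) :
    MemLp (zFun F E c N φ) 2 (weightedTruncMeasure F E c N k c₁ μZ) :=
  (memLp_iotaFun hb (toHX F E c N k μ φ hφ2)).ae_eq (iotaFun_toHX_ae_eq_zFun hb hφ hφ2)

/-- **THE ℓ8 COMPATIBILITY `ι (toHX φ) = toHN φ`** (any two `MemLp` witnesses): both sides are a.e. `zFun φ` (★ `coeFn_iota`, §1, ★ `coeFn_toHN`).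
[cite: BernsteinLapid2019, §4 Claim 4 p. 10] -/
theorem iota_toHX_eq_toHN (hb : IotaBound F E c N k c₁ μ μZ) {φ : (quasiSplit F E c N).Adelic → ℂ}
    (hφ : ∀ γ ∈ (quasiSplit F E c N).quotientSubgroup, ∀ g, φ (γ * g) = φ g)
    (hφ2 : MemLp ((quasiSplit F E c N).quotFun φ) 2 (μ.withDensity fun x => (((supHeight F E c N x)⁻¹ ^ (2 * k) : ℝ≥0) : ℝ≥0∞)))
    (hφZ : MemLp (zFun F E c N φ) 2 (weightedTruncMeasure F E c N k c₁ μZ)) :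
    iota hb (toHX F E c N k μ φ hφ2) = toHN F E c N k c₁ μZ φ hφZ :=
  Lp.ext (((coeFn_iota hb _).trans (iotaFun_toHX_ae_eq_zFun hb hφ hφ2)).trans (coeFn_toHN F E c N k c₁ μZ φ hφZ).symm)

end Compat

/-! ## §2 (S2) The constant-term equation `cnst_N (ι (toHX E_z)) = φ₀•[H^z] + b•[H^{1−z}]` on `U(1,1)_{L/L⁺}` -/

section ConstantTerm

variable (L : Type) [Field L] [NumberField L] [IsCMField L]
variable [MeasurableSpace (quasiSplit (↥(maximalRealSubfield L)) L (IsCMField.complexConj L) 2).Adelic] [BorelSpace (quasiSplit (↥(maximalRealSubfield L)) L (IsCMField.complexConj L) 2).Adelic]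

omit [MeasurableSpace (quasiSplit (↥(maximalRealSubfield L)) L (IsCMField.complexConj L) 2).Adelic] [BorelSpace (quasiSplit (↥(maximalRealSubfield L)) L (IsCMField.complexConj L) 2).Adelic] in
/-- `E(φ₀H^z)` (`Re z > 1`) is left-`G(F)`-invariant in the `quotientSubgroup` spelling (★ `eisensteinSeriesU_flatSectionU_rational_mul`, ★ `quotientSubgroup_quasiSplit`).
[cite: MoeglinWaldspurger1995, II.1.5] -/
theorem eisensteinSeriesU_flatSectionU_quotientSubgroup_mul (φ₀ z : ℂ) :
    ∀ γ ∈ (quasiSplit (↥(maximalRealSubfield L)) L (IsCMField.complexConj L) 2).quotientSubgroup, ∀ g : (quasiSplit (↥(maximalRealSubfield L)) L (IsCMField.complexConj L) 2).Adelic, (eisensteinSeriesU (flatSectionU (fun _ : (quasiSplit (↥(maximalRealSubfield L)) L (IsCMField.complexConj L) 2).Adelic => φ₀) z)) (γ * g) = (eisensteinSeriesU (flatSectionU (fun _ : (quasiSplit (↥(maximalRealSubfield L)) L (IsCMField.complexConj L) 2).Adelic => φ₀) z)) g := by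
  intro γ hγ g
  rw [quotientSubgroup_quasiSplit] at hγ
  obtain ⟨γ', hγ'⟩ := MonoidHom.mem_range.1 hγ
  rw [← hγ']
  exact eisensteinSeriesU_flatSectionU_rational_mul (φ := fun _ : (quasiSplit (↥(maximalRealSubfield L)) L (IsCMField.complexConj L) 2).Adelic => φ₀) (fun _ _ _ => rfl) z γ' g

/-- The constant term of `E(φ₀H^z)` along `B` IS the function `φ₀•H^z + b•H^{1−z}` for the (Ξ₂)₂ coefficient `b` (★ `exists_borelConstantTerm_sphericalEisenstein_sub_eq_mul_cm_two`,
read as an identity of functions). [cite: BernsteinLapid2019, §7] [cite: MoeglinWaldspurger1995, II.1.7] -/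
theorem exists_borelConstantTerm_eisensteinSeriesU_eq_smul_add_smul_cm_two
    (ν : Measure ↥(adelicUnipotent (↥(maximalRealSubfield L)) L (IsCMField.complexConj L) 2)) [ν.IsHaarMeasure]
    {𝓕 : Set ↥(adelicUnipotent (↥(maximalRealSubfield L)) L (IsCMField.complexConj L) 2)}
    (h𝓕N : IsFundamentalDomain ↥(rationalUnipotent (↥(maximalRealSubfield L)) L (IsCMField.complexConj L) 2) 𝓕 ν) (h𝓕c : IsCompact (closure 𝓕))
    (φ₀ : ℂ) {z : ℂ} (hz : 1 < z.re) :
    ∃ b : ℂ, borelConstantTerm ν 𝓕 (eisensteinSeriesU (flatSectionU (fun _ : (quasiSplit (↥(maximalRealSubfield L)) L (IsCMField.complexConj L) 2).Adelic => φ₀) z)) =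
      φ₀ • (fun g : (quasiSplit (↥(maximalRealSubfield L)) L (IsCMField.complexConj L) 2).Adelic => (((borelHeight g : ℝ)) : ℂ) ^ z) + b • (fun g : (quasiSplit (↥(maximalRealSubfield L)) L (IsCMField.complexConj L) 2).Adelic => (((borelHeight g : ℝ)) : ℂ) ^ (1 - z)) := by
  obtain ⟨b, hb⟩ := exists_borelConstantTerm_sphericalEisenstein_sub_eq_mul_cm_two L ν h𝓕N h𝓕c φ₀ hz
  refine ⟨b, funext fun g => ?_⟩
  simp only [Pi.add_apply, Pi.smul_apply, smul_eq_mul]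
  linear_combination hb g

omit [MeasurableSpace (quasiSplit (↥(maximalRealSubfield L)) L (IsCMField.complexConj L) 2).Adelic] [BorelSpace (quasiSplit (↥(maximalRealSubfield L)) L (IsCMField.complexConj L) 2).Adelic] in
/-- `g ↦ H(g)^w` is continuous on `G(𝔸)` for every `w : ℂ` (`H > 0` continuous; ★ `continuous_flatSectionU` at `φ = 1`). [cite: MoeglinWaldspurger1995, I.2.2] -/
theorem continuous_borelHeight_cpow (w : ℂ) : Continuous fun g : (quasiSplit (↥(maximalRealSubfield L)) L (IsCMField.complexConj L) 2).Adelic => (((borelHeight g : ℝ)) : ℂ) ^ w := by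
  exact (continuous_flatSectionU (continuous_const : Continuous fun _ : (quasiSplit (↥(maximalRealSubfield L)) L (IsCMField.complexConj L) 2).Adelic => (1 : ℂ)) w).congr fun g => by
    rw [flatSectionU_apply, one_mul]

/-- **(S2) THE CONSTANT-TERM EQUATION FOR `E_z` IN `𝓗_k(Z_a)`.**  On `U(1,1)_{L/L⁺}`, for `1 < Re z`, any witness `hE : [Ẽ_z] ∈ 𝓗_k(𝔛)` (e.g. ★ (b1)), the pull-back
`ι = iota hb` of ★ leaf 2 and the constant-term projection `cnst_N = cnstN k a μZ` of ★ leaf 1: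
`cnst_N (ι [Ẽ_z]) = φ₀ • toHN (H^z) + b • toHN (H^{1−z})` for some `b : ℂ` (the (Ξ₂)₂ coefficient) — §1 (`ι (toHX E_z) = toHN E_z`), ★ P2b′
`cnstN_toHN_eq_toHN_borelConstantTerm'` (letter `hdis'` = invariance of `wtm_{k,a} μZ` under the fibre average, ★ p858957 under the structural letters), the
pointwise constant term ★ (Ξ₂)₂, and linearity of `toHN`. Letters `hα₁`, `hα₂` = square-integrability of the `Z`-lifts of `H^z`, `H^{1−z}` (the definability of the B–L
vectors `α₁(z)`, `α₂(z)`, file ℓ7). [cite: BernsteinLapid2019, §4 (p. 10), §7] [cite: MoeglinWaldspurger1995, I.2.6, II.1.7] -/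
theorem exists_cnstN_iota_toHX_eisensteinSeriesU_eq_cm_two
    (ν : Measure ↥(adelicUnipotent (↥(maximalRealSubfield L)) L (IsCMField.complexConj L) 2)) [ν.IsHaarMeasure] [ν.IsMulRightInvariant]
    {𝓕 : Set ↥(adelicUnipotent (↥(maximalRealSubfield L)) L (IsCMField.complexConj L) 2)}
    (h𝓕N : IsFundamentalDomain ↥(rationalUnipotent (↥(maximalRealSubfield L)) L (IsCMField.complexConj L) 2) 𝓕 ν) (h𝓕c : IsCompact (closure 𝓕))
    {μ : Measure (quasiSplit (↥(maximalRealSubfield L)) L (IsCMField.complexConj L) 2).automorphicQuotient} {k : ℕ} {a : ℝ≥0} {μZ : Measure (borelQuotient (↥(maximalRealSubfield L)) L (IsCMField.complexConj L) 2)} [IsFiniteMeasure (weightedTruncMeasure (↥(maximalRealSubfield L)) L (IsCMField.complexConj L) 2 k a μZ)]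
    (hb : IotaBound (↥(maximalRealSubfield L)) L (IsCMField.complexConj L) 2 k a μ μZ)
    (hdis' : ∀ Φ : (quasiSplit (↥(maximalRealSubfield L)) L (IsCMField.complexConj L) 2).Adelic → ℂ, Measurable Φ → (∀ b ∈ ratBorelSubgroup (↥(maximalRealSubfield L)) L (IsCMField.complexConj L) 2, ∀ g, Φ (b * g) = Φ g) →
      Integrable (zFun (↥(maximalRealSubfield L)) L (IsCMField.complexConj L) 2 Φ) (weightedTruncMeasure (↥(maximalRealSubfield L)) L (IsCMField.complexConj L) 2 k a μZ) →
      Integrable (zFun (↥(maximalRealSubfield L)) L (IsCMField.complexConj L) 2 (borelConstantTerm ν 𝓕 Φ)) (weightedTruncMeasure (↥(maximalRealSubfield L)) L (IsCMField.complexConj L) 2 k a μZ) →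
        ∫ x, zFun (↥(maximalRealSubfield L)) L (IsCMField.complexConj L) 2 (borelConstantTerm ν 𝓕 Φ) x ∂(weightedTruncMeasure (↥(maximalRealSubfield L)) L (IsCMField.complexConj L) 2 k a μZ) = ∫ x, zFun (↥(maximalRealSubfield L)) L (IsCMField.complexConj L) 2 Φ x ∂(weightedTruncMeasure (↥(maximalRealSubfield L)) L (IsCMField.complexConj L) 2 k a μZ))
    (φ₀ : ℂ) {z : ℂ} (hz : 1 < z.re) (hE : MemLp ((quasiSplit (↥(maximalRealSubfield L)) L (IsCMField.complexConj L) 2).quotFun (eisensteinSeriesU (flatSectionU (fun _ : (quasiSplit (↥(maximalRealSubfield L)) L (IsCMField.complexConj L) 2).Adelic => φ₀) z))) 2 (μ.withDensity fun x => (((supHeight (↥(maximalRealSubfield L)) L (IsCMField.complexConj L) 2 x)⁻¹ ^ (2 * k) : ℝ≥0) : ℝ≥0∞)))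
    (hα₁ : MemLp (zFun (↥(maximalRealSubfield L)) L (IsCMField.complexConj L) 2 (fun g : (quasiSplit (↥(maximalRealSubfield L)) L (IsCMField.complexConj L) 2).Adelic => (((borelHeight g : ℝ)) : ℂ) ^ z)) 2 (weightedTruncMeasure (↥(maximalRealSubfield L)) L (IsCMField.complexConj L) 2 k a μZ))
    (hα₂ : MemLp (zFun (↥(maximalRealSubfield L)) L (IsCMField.complexConj L) 2 (fun g : (quasiSplit (↥(maximalRealSubfield L)) L (IsCMField.complexConj L) 2).Adelic => (((borelHeight g : ℝ)) : ℂ) ^ (1 - z))) 2 (weightedTruncMeasure (↥(maximalRealSubfield L)) L (IsCMField.complexConj L) 2 k a μZ)) :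
    ∃ b : ℂ, cnstN (↥(maximalRealSubfield L)) L (IsCMField.complexConj L) 2 k a μZ (iota hb (toHX (↥(maximalRealSubfield L)) L (IsCMField.complexConj L) 2 k μ (eisensteinSeriesU (flatSectionU (fun _ : (quasiSplit (↥(maximalRealSubfield L)) L (IsCMField.complexConj L) 2).Adelic => φ₀) z)) hE)) =
      φ₀ • toHN (↥(maximalRealSubfield L)) L (IsCMField.complexConj L) 2 k a μZ (fun g : (quasiSplit (↥(maximalRealSubfield L)) L (IsCMField.complexConj L) 2).Adelic => (((borelHeight g : ℝ)) : ℂ) ^ z) hα₁ + b • toHN (↥(maximalRealSubfield L)) L (IsCMField.complexConj L) 2 k a μZ (fun g : (quasiSplit (↥(maximalRealSubfield L)) L (IsCMField.complexConj L) 2).Adelic => (((borelHeight g : ℝ)) : ℂ) ^ (1 - z)) hα₂ := by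
  obtain ⟨b, hct⟩ := exists_borelConstantTerm_eisensteinSeriesU_eq_smul_add_smul_cm_two L ν h𝓕N h𝓕c φ₀ hz
  refine ⟨b, ?_⟩
  -- invariances and measurability of `E_z`
  have hφ := eisensteinSeriesU_flatSectionU_quotientSubgroup_mul L φ₀ z
  have hφB : ∀ γ ∈ ratBorelSubgroup (↥(maximalRealSubfield L)) L (IsCMField.complexConj L) 2, ∀ g : (quasiSplit (↥(maximalRealSubfield L)) L (IsCMField.complexConj L) 2).Adelic, (eisensteinSeriesU (flatSectionU (fun _ : (quasiSplit (↥(maximalRealSubfield L)) L (IsCMField.complexConj L) 2).Adelic => φ₀) z)) (γ * g) = (eisensteinSeriesU (flatSectionU (fun _ : (quasiSplit (↥(maximalRealSubfield L)) L (IsCMField.complexConj L) 2).Adelic => φ₀) z)) g := fun γ hγ g =>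
    hφ γ ((quasiSplit (↥(maximalRealSubfield L)) L (IsCMField.complexConj L) 2).arithmeticSubgroup_le_quotientSubgroup (ratBorelSubgroup_le_arithmeticSubgroup (↥(maximalRealSubfield L)) L (IsCMField.complexConj L) 2 hγ)) g
  have hφm : Measurable (eisensteinSeriesU (flatSectionU (fun _ : (quasiSplit (↥(maximalRealSubfield L)) L (IsCMField.complexConj L) 2).Adelic => φ₀) z)) := (continuous_eisensteinSeriesU_flatSectionU_cm_two L hz (φ := fun _ : (quasiSplit (↥(maximalRealSubfield L)) L (IsCMField.complexConj L) 2).Adelic => φ₀) continuous_const (M := ‖φ₀‖) fun _ => le_rfl).measurable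
  -- the `Z`-lift of `E_z` and of its constant term are in `L²(wtm)`; the constant term is continuous
  have hφZ : MemLp (zFun (↥(maximalRealSubfield L)) L (IsCMField.complexConj L) 2 (eisensteinSeriesU (flatSectionU (fun _ : (quasiSplit (↥(maximalRealSubfield L)) L (IsCMField.complexConj L) 2).Adelic => φ₀) z))) 2 (weightedTruncMeasure (↥(maximalRealSubfield L)) L (IsCMField.complexConj L) 2 k a μZ) := memLp_zFun_of_iotaBound hb hφ hE
  have hψ2 : MemLp (zFun (↥(maximalRealSubfield L)) L (IsCMField.complexConj L) 2 (borelConstantTerm ν 𝓕 (eisensteinSeriesU (flatSectionU (fun _ : (quasiSplit (↥(maximalRealSubfield L)) L (IsCMField.complexConj L) 2).Adelic => φ₀) z)))) 2 (weightedTruncMeasure (↥(maximalRealSubfield L)) L (IsCMField.complexConj L) 2 k a μZ) := by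
    rw [hct, zFun_add, zFun_smul, zFun_smul]
    exact (hα₁.const_smul φ₀).add (hα₂.const_smul b)
  have hψc : Continuous (borelConstantTerm ν 𝓕 (eisensteinSeriesU (flatSectionU (fun _ : (quasiSplit (↥(maximalRealSubfield L)) L (IsCMField.complexConj L) 2).Adelic => φ₀) z))) := by
    rw [hct]
    exact ((continuous_borelHeight_cpow L z).const_smul φ₀).add ((continuous_borelHeight_cpow L (1 - z)).const_smul b)
  -- §1 compatibility, ★ P2b′, then linearity of `toHN` read a.e.
  rw [iota_toHX_eq_toHN hb hφ hE hφZ, cnstN_toHN_eq_toHN_borelConstantTerm' ν 𝓕 k a μZ h𝓕N hdis' hφm hφB hφZ hψ2 hψc]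
  refine Lp.ext ((coeFn_toHN (↥(maximalRealSubfield L)) L (IsCMField.complexConj L) 2 k a μZ _ hψ2).trans ?_)
  refine EventuallyEq.trans ?_ ((Lp.coeFn_add _ _).trans ((Lp.coeFn_smul _ _).add (Lp.coeFn_smul _ _))).symm
  filter_upwards [coeFn_toHN (↥(maximalRealSubfield L)) L (IsCMField.complexConj L) 2 k a μZ _ hα₁, coeFn_toHN (↥(maximalRealSubfield L)) L (IsCMField.complexConj L) 2 k a μZ _ hα₂] with x h₁ h₂
  rw [Pi.add_apply, Pi.smul_apply, Pi.smul_apply, h₁, h₂, hct, zFun_add, zFun_smul, zFun_smul]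
  rfl

end ConstantTerm

/-! ## §3 Generic Hilbert space: the projection onto the closed span of `𝒮` kills `𝒮ᗮ` -/

section Hilbert

/-- In a Hilbert space, if `v ⊥ s` for every `s ∈ 𝒮` then the orthogonal projection of `v` onto the CLOSED SPAN of `𝒮` vanishes (Mathlib
`Submodule.starProjection_apply_eq_zero_iff`, `Submodule.orthogonal_closure`, `Submodule.span_induction`). [cite: BernsteinLapid2019, §4 Claim 2 p. 9] -/
theorem starProjection_topologicalClosure_span_eq_zero {H : Type*} [NormedAddCommGroup H] [InnerProductSpace ℂ H] [CompleteSpace H]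
    {𝒮 : Set H} {v : H} (h : ∀ s ∈ 𝒮, inner ℂ s v = 0) :
    (Submodule.span ℂ 𝒮).topologicalClosure.starProjection v = 0 := by
  rw [Submodule.starProjection_apply_eq_zero_iff, Submodule.orthogonal_closure, Submodule.mem_orthogonal]
  intro u hu
  induction hu using Submodule.span_induction with
  | mem s hs => exact h s hs
  | zero => exact inner_zero_left _
  | add x y _ _ hx hy => rw [inner_add_left, hx, hy, add_zero]
  | smul a x _ hx => rw [inner_smul_left, hx, mul_zero]

end Hilbert

/-! ## §4 (S3) `Q [Ẽ_z] = 0`: the finiteness letter `hX` discharged, the inner products vanish, the projection vanishes -/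

section CuspOrthogonal

variable (L : Type) [Field L] [NumberField L] [IsCMField L]
variable [MeasurableSpace (quasiSplit (↥(maximalRealSubfield L)) L (IsCMField.complexConj L) 2).Adelic] [BorelSpace (quasiSplit (↥(maximalRealSubfield L)) L (IsCMField.complexConj L) 2).Adelic]

/-- **THE MAJORANT OF THE NORM SERIES IN TRACK A's INDEX**: for `1 < Re z ≤ k`,
`Σ'_{q ∈ Γ_B∖Γ} ‖f_z(q·g)‖ₑ ≤ ofReal (‖φ₀‖·C·w₁(g)^k)` with ONE `C` (★ dictionary `exists_equiv_arithmeticBorelQuot` ∕ `apply_out_eq` to pass to `B(F)∖G(F)`,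
`‖f_z‖ = ‖φ₀‖·H^{Re z}`, ★ Godement summability to commute `ofReal` with the sum, ★ (b1) `tsum_borelHeight_rpow_le_uniform_cm_two` on `[Re z, k]`).
[cite: BernsteinLapid2019, §7] [cite: MoeglinWaldspurger1995, II.1.5, IV.1.8] -/
theorem exists_tsum_enorm_flatSectionU_le_cm_two {δ : L} (hcδ : IsCMField.complexConj L δ = -δ) (hδ : δ ≠ 0)
    (ν : Measure ↥(adelicUnipotent (↥(maximalRealSubfield L)) L (IsCMField.complexConj L) 2)) [ν.IsHaarMeasure]
    {𝓕 : Set ↥(adelicUnipotent (↥(maximalRealSubfield L)) L (IsCMField.complexConj L) 2)}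
    (h𝓕N : IsFundamentalDomain ↥(rationalUnipotent (↥(maximalRealSubfield L)) L (IsCMField.complexConj L) 2) 𝓕 ν) (h𝓕c : IsCompact (closure 𝓕)) (φ₀ : ℂ) {z : ℂ} (hz : 1 < z.re) {k : ℕ} (hzk : z.re ≤ k) :
    ∃ C : ℝ, 0 ≤ C ∧ ∀ g : (quasiSplit (↥(maximalRealSubfield L)) L (IsCMField.complexConj L) 2).Adelic,
      (∑' q : Quotient (QuotientGroup.rightRel (arithmeticBorel (↥(maximalRealSubfield L)) L (IsCMField.complexConj L) 2)), ‖(flatSectionU (fun _ : (quasiSplit (↥(maximalRealSubfield L)) L (IsCMField.complexConj L) 2).Adelic => φ₀) z) (((q.out : (quasiSplit (↥(maximalRealSubfield L)) L (IsCMField.complexConj L) 2).arithmeticSubgroup) : (quasiSplit (↥(maximalRealSubfield L)) L (IsCMField.complexConj L) 2).Adelic) * g)‖ₑ) ≤ ENNReal.ofReal (‖φ₀‖ * C * ((((⨆ γ : (quasiSplit (↥(maximalRealSubfield L)) L (IsCMField.complexConj L) 2).arithmeticSubgroup, borelHeight ((γ : (quasiSplit (↥(maximalRealSubfield L)) L (IsCMField.complexConj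 L) 2).Adelic) * g)) : ℝ≥0) : ℝ)) ^ ((k : ℕ) : ℝ)) := by
  obtain ⟨C, hC, hmaj⟩ := tsum_borelHeight_rpow_le_uniform_cm_two L hcδ hδ ν h𝓕N h𝓕c (σ₁ := z.re) (σ₂ := ((k : ℕ) : ℝ)) hz
  refine ⟨C, hC, fun g => ?_⟩
  obtain ⟨κ, hκ⟩ := exists_equiv_arithmeticBorelQuot (F := ↥(maximalRealSubfield L)) (E := L) (c := IsCMField.complexConj L) (N := 2)
  have hψ : ∀ b ∈ arithmeticBorel (↥(maximalRealSubfield L)) L (IsCMField.complexConj L) 2, ∀ x : (quasiSplit (↥(maximalRealSubfield L)) L (IsCMField.complexConj L) 2).Adelic, (fun y : (quasiSplit (↥(maximalRealSubfield L)) L (IsCMField.complexConj L) 2).Adelic => ‖(flatSectionU (fun _ : (quasiSplit (↥(maximalRealSubfield L)) L (IsCMField.complexConj L) 2).Adelic => φ₀) z) y‖ₑ) ((b : (quasiSplit (↥(maximalRealSubfield L)) L (IsCMField.complexConj L) 2).Adelic) * x) = (fun y : (quasiSplit (↥(maximalRealSubfield L)) L (IsCMField.complexConj L) 2).Adelic =>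 ‖(flatSectionU (fun _ : (quasiSplit (↥(maximalRealSubfield L)) L (IsCMField.complexConj L) 2).Adelic => φ₀) z) y‖ₑ) x := fun b hb x => by
    simp only [flatSectionU_apply, borelHeight_arithmeticBorel_mul' hb x]
  rw [← κ.tsum_eq]
  refine (le_of_eq (tsum_congr fun q => apply_out_eq (ψ := fun y : (quasiSplit (↥(maximalRealSubfield L)) L (IsCMField.complexConj L) 2).Adelic => ‖(flatSectionU (fun _ : (quasiSplit (↥(maximalRealSubfield L)) L (IsCMField.complexConj L) 2).Adelic => φ₀) z) y‖ₑ) hψ κ hκ q g)).trans ?_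
  have hterm : ∀ q : Quotient (MulAction.orbitRel ↥(borelU ((IsCMField.complexConj L : L ≃ₐ[↥(maximalRealSubfield L)] L) : L →+* L) ((StdForm.antidiagonal 2).over L)) ↥(unitaryGroupOfForm ((IsCMField.complexConj L : L ≃ₐ[↥(maximalRealSubfield L)] L) : L →+* L) ((StdForm.antidiagonal 2).over L))),
      (fun y : (quasiSplit (↥(maximalRealSubfield L)) L (IsCMField.complexConj L) 2).Adelic => ‖(flatSectionU (fun _ : (quasiSplit (↥(maximalRealSubfield L)) L (IsCMField.complexConj L) 2).Adelic => φ₀) z) y‖ₑ) ((quasiSplit (↥(maximalRealSubfield L)) L (IsCMField.complexConj L) 2).toAdelic (q.out : ↥(unitaryGroupOfForm ((IsCMField.complexConj L : L ≃ₐ[↥(maximalRealSubfield L)] L) : L →+* L) ((StdForm.antidiagonal 2).over L))) * g) =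
        ENNReal.ofReal (‖φ₀‖ * ((borelHeight ((quasiSplit (↥(maximalRealSubfield L)) L (IsCMField.complexConj L) 2).toAdelic (q.out : ↥(unitaryGroupOfForm ((IsCMField.complexConj L : L ≃ₐ[↥(maximalRealSubfield L)] L) : L →+* L) ((StdForm.antidiagonal 2).over L))) * g) : ℝ)) ^ z.re) :=
    fun q => by
      simp only [← ofReal_norm, flatSectionU_apply, norm_mul, Complex.norm_cpow_eq_rpow_re_of_pos (show (0 : ℝ) < (borelHeight ((quasiSplit (↥(maximalRealSubfield L)) L (IsCMField.complexConj L) 2).toAdelic (q.out : ↥(unitaryGroupOfForm ((IsCMField.complexConj L : L ≃ₐ[↥(maximalRealSubfield L)] L) : L →+* L) ((StdForm.antidiagonal 2).over L))) * g) : ℝ) by exact_mod_cast borelHeight_pos _)]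
  rw [tsum_congr hterm, ← ENNReal.ofReal_tsum_of_nonneg (fun q => by positivity) ((summable_borelHeight_rpow_cm_two L hz g).mul_left ‖φ₀‖), tsum_mul_left]
  refine ENNReal.ofReal_le_ofReal ?_
  rw [mul_assoc]
  exact mul_le_mul_of_nonneg_left (hmaj z.re le_rfl hzk g) (norm_nonneg _)

/-- **THE FINITENESS LETTER `hX` (ℓ10) OF ★ «E ⊥ 𝒞_k», DISCHARGED** for `f = f_z`, `1 < Re z ≤ k`, and a test function `φ` with `φ̃ ∈ L²(μ)` and `w₁^{2k}φ̃ ∈ L²(μ)` (clauses 3–4 of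
`cuspTestClass k`): `∫⁻_𝔛 (Σ_q ‖f_z(q x̃⁻¹)‖ₑ)·‖φ̃ x‖ₑ dμ < ∞` — the majorant above at `g = x̃⁻¹` (`w₁(x̃⁻¹) = supHeight x`, ★ `supHeight_eq_ciSup_arithmetic`) and
`w₁^k ≤ 1 + w₁^{2k}`, `φ̃, w₁^{2k}φ̃ ∈ L²(μ) ⊂ L¹(μ)` (`μ` finite). [cite: BernsteinLapid2019, §4 Claim 2 p. 9, §7] [cite: MoeglinWaldspurger1995, II.1.7] -/
theorem lintegral_tsum_enorm_flatSectionU_mul_enorm_lt_top_cm_two {δ : L} (hcδ : IsCMField.complexConj L δ = -δ) (hδ : δ ≠ 0)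
    (ν : Measure ↥(adelicUnipotent (↥(maximalRealSubfield L)) L (IsCMField.complexConj L) 2)) [ν.IsHaarMeasure]
    {𝓕 : Set ↥(adelicUnipotent (↥(maximalRealSubfield L)) L (IsCMField.complexConj L) 2)}
    (h𝓕N : IsFundamentalDomain ↥(rationalUnipotent (↥(maximalRealSubfield L)) L (IsCMField.complexConj L) 2) 𝓕 ν) (h𝓕c : IsCompact (closure 𝓕)) (μ : Measure (quasiSplit (↥(maximalRealSubfield L)) L (IsCMField.complexConj L) 2).automorphicQuotient) [IsFiniteMeasure μ] (φ₀ : ℂ) {z : ℂ} (hz : 1 < z.re) {k : ℕ} (hzk : z.re ≤ k)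
    {φ : (quasiSplit (↥(maximalRealSubfield L)) L (IsCMField.complexConj L) 2).Adelic → ℂ} (hφ2 : MemLp ((quasiSplit (↥(maximalRealSubfield L)) L (IsCMField.complexConj L) 2).quotFun φ) 2 μ)
    (hφw : MemLp (fun x => ((supHeight (↥(maximalRealSubfield L)) L (IsCMField.complexConj L) 2 x : ℝ) ^ (2 * k) : ℂ) * (quasiSplit (↥(maximalRealSubfield L)) L (IsCMField.complexConj L) 2).quotFun φ x) 2 μ) :
    ∫⁻ x, (∑' q : Quotient (QuotientGroup.rightRel (arithmeticBorel (↥(maximalRealSubfield L)) L (IsCMField.complexConj L) 2)), ‖(flatSectionU (fun _ : (quasiSplit (↥(maximalRealSubfield L)) L (IsCMField.complexConj L) 2).Adelic => φ₀) z) (((q.out : (quasiSplit (↥(maximalRealSubfield L)) L (IsCMField.complexConj L) 2).arithmeticSubgroup) : (quasiSplit (↥(maximalRealSubfield L)) L (IsCMField.complexConj L) 2).Adelic) * (Quotient.out x : (quasiSplit (↥(maximalRealSubfield L)) L (IsCMField.complexConj L) 2).Adelic)⁻¹)‖ₑ) * ‖(quasiSplit (↥(maximalRealSubfield L)) L (IsCMField.complexConj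 L) 2).quotFun φ x‖ₑ ∂μ < ∞ := by
  obtain ⟨C, hC, hbd⟩ := exists_tsum_enorm_flatSectionU_le_cm_two L hcδ hδ ν h𝓕N h𝓕c φ₀ hz hzk
  -- pointwise: `S(x)·‖φ̃ x‖ₑ ≤ ofReal(‖φ₀‖C)·(‖φ̃ x‖ₑ + ‖w₁^{2k}φ̃ x‖ₑ)`
  have hpt : ∀ x : (quasiSplit (↥(maximalRealSubfield L)) L (IsCMField.complexConj L) 2).automorphicQuotient,
      (∑' q : Quotient (QuotientGroup.rightRel (arithmeticBorel (↥(maximalRealSubfield L)) L (IsCMField.complexConj L) 2)), ‖(flatSectionU (fun _ : (quasiSplit (↥(maximalRealSubfield L)) L (IsCMField.complexConj L) 2).Adelic => φ₀) z) (((q.out : (quasiSplit (↥(maximalRealSubfield L)) L (IsCMField.complexConj L) 2).arithmeticSubgroup) : (quasiSplit (↥(maximalRealSubfield L)) L (IsCMField.complexConj L) 2).Adelic) * (Quotient.out x : (quasiSplit (↥(maximalRealSubfield L)) L (IsCMField.complexConj L) 2).Adelic)⁻¹)‖ₑ) * ‖(quasiSplit (↥(maximalRealSubfield L)) L (IsCMField.complexConj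 L) 2).quotFun φ x‖ₑ ≤
        ENNReal.ofReal (‖φ₀‖ * C) * (‖(quasiSplit (↥(maximalRealSubfield L)) L (IsCMField.complexConj L) 2).quotFun φ x‖ₑ + ‖((supHeight (↥(maximalRealSubfield L)) L (IsCMField.complexConj L) 2 x : ℝ) ^ (2 * k) : ℂ) * (quasiSplit (↥(maximalRealSubfield L)) L (IsCMField.complexConj L) 2).quotFun φ x‖ₑ) := by
    intro x
    have hW : (((⨆ γ : (quasiSplit (↥(maximalRealSubfield L)) L (IsCMField.complexConj L) 2).arithmeticSubgroup, borelHeight ((γ : (quasiSplit (↥(maximalRealSubfield L)) L (IsCMField.complexConj L) 2).Adelic) * (Quotient.out x : (quasiSplit (↥(maximalRealSubfield L)) L (IsCMField.complexConj L) 2).Adelic)⁻¹)) : ℝ≥0) : ℝ) = (supHeight (↥(maximalRealSubfield L)) L (IsCMField.complexConj L) 2 x : ℝ) := by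
      rw [supHeight_eq_ciSup_arithmetic]
    have h1 := hbd (Quotient.out x : (quasiSplit (↥(maximalRealSubfield L)) L (IsCMField.complexConj L) 2).Adelic)⁻¹
    rw [hW, Real.rpow_natCast] at h1
    set w : ℝ := (supHeight (↥(maximalRealSubfield L)) L (IsCMField.complexConj L) 2 x : ℝ) with hw
    have hw0 : 0 ≤ w := NNReal.coe_nonneg _
    have hwk : w ^ k ≤ 1 + w ^ (2 * k) := by
      rcases le_or_gt w 1 with h | h
      · exact (pow_le_one₀ hw0 h).trans (le_add_of_nonneg_right (by positivity))
      · exact (pow_le_pow_right₀ h.le (by omega : k ≤ 2 * k)).trans (le_add_of_nonneg_left zero_le_one)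
    have hnw : ‖((supHeight (↥(maximalRealSubfield L)) L (IsCMField.complexConj L) 2 x : ℝ) ^ (2 * k) : ℂ) * (quasiSplit (↥(maximalRealSubfield L)) L (IsCMField.complexConj L) 2).quotFun φ x‖ₑ = ENNReal.ofReal (w ^ (2 * k)) * ‖(quasiSplit (↥(maximalRealSubfield L)) L (IsCMField.complexConj L) 2).quotFun φ x‖ₑ := by
      rw [enorm_mul, ← ofReal_norm (((supHeight (↥(maximalRealSubfield L)) L (IsCMField.complexConj L) 2 x : ℝ) : ℂ) ^ (2 * k)), norm_pow, Complex.norm_real, Real.norm_of_nonneg hw0]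
    rw [hnw]
    calc (∑' q : Quotient (QuotientGroup.rightRel (arithmeticBorel (↥(maximalRealSubfield L)) L (IsCMField.complexConj L) 2)), ‖(flatSectionU (fun _ : (quasiSplit (↥(maximalRealSubfield L)) L (IsCMField.complexConj L) 2).Adelic => φ₀) z) (((q.out : (quasiSplit (↥(maximalRealSubfield L)) L (IsCMField.complexConj L) 2).arithmeticSubgroup) : (quasiSplit (↥(maximalRealSubfield L)) L (IsCMField.complexConj L) 2).Adelic) * (Quotient.out x : (quasiSplit (↥(maximalRealSubfield L)) L (IsCMField.complexConj L) 2).Adelic)⁻¹)‖ₑ) * ‖(quasiSplit (↥(maximalRealSubfield L)) L (IsCMField.complexConj L) 2).quotFun φ x‖ₑ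
        ≤ ENNReal.ofReal (‖φ₀‖ * C * w ^ k) * ‖(quasiSplit (↥(maximalRealSubfield L)) L (IsCMField.complexConj L) 2).quotFun φ x‖ₑ := mul_le_mul' h1 le_rfl
      _ ≤ ENNReal.ofReal (‖φ₀‖ * C * (1 + w ^ (2 * k))) * ‖(quasiSplit (↥(maximalRealSubfield L)) L (IsCMField.complexConj L) 2).quotFun φ x‖ₑ :=
          mul_le_mul' (ENNReal.ofReal_le_ofReal (mul_le_mul_of_nonneg_left hwk (mul_nonneg (norm_nonneg _) hC))) le_rfl
      _ = ENNReal.ofReal (‖φ₀‖ * C) * (‖(quasiSplit (↥(maximalRealSubfield L)) L (IsCMField.complexConj L) 2).quotFun φ x‖ₑ + ENNReal.ofReal (w ^ (2 * k)) * ‖(quasiSplit (↥(maximalRealSubfield L)) L (IsCMField.complexConj L) 2).quotFun φ x‖ₑ) := by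
          rw [ENNReal.ofReal_mul (mul_nonneg (norm_nonneg _) hC), ENNReal.ofReal_add zero_le_one (by positivity), ENNReal.ofReal_one]
          ring
  -- integrate: both summands have finite integral (`L² ⊂ L¹`, `μ` finite)
  have hI1 : ∫⁻ x, ‖(quasiSplit (↥(maximalRealSubfield L)) L (IsCMField.complexConj L) 2).quotFun φ x‖ₑ ∂μ < ∞ := (hφ2.integrable one_le_two).2
  have hI2 : ∫⁻ x, ‖((supHeight (↥(maximalRealSubfield L)) L (IsCMField.complexConj L) 2 x : ℝ) ^ (2 * k) : ℂ) * (quasiSplit (↥(maximalRealSubfield L)) L (IsCMField.complexConj L) 2).quotFun φ x‖ₑ ∂μ < ∞ := (hφw.integrable one_le_two).2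
  calc ∫⁻ x, (∑' q : Quotient (QuotientGroup.rightRel (arithmeticBorel (↥(maximalRealSubfield L)) L (IsCMField.complexConj L) 2)), ‖(flatSectionU (fun _ : (quasiSplit (↥(maximalRealSubfield L)) L (IsCMField.complexConj L) 2).Adelic => φ₀) z) (((q.out : (quasiSplit (↥(maximalRealSubfield L)) L (IsCMField.complexConj L) 2).arithmeticSubgroup) : (quasiSplit (↥(maximalRealSubfield L)) L (IsCMField.complexConj L) 2).Adelic) * (Quotient.out x : (quasiSplit (↥(maximalRealSubfield L)) L (IsCMField.complexConj L) 2).Adelic)⁻¹)‖ₑ) * ‖(quasiSplit (↥(maximalRealSubfield L)) L (IsCMField.complexConj L) 2).quotFun φ x‖ₑ ∂μ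
      ≤ ∫⁻ x, ENNReal.ofReal (‖φ₀‖ * C) * (‖(quasiSplit (↥(maximalRealSubfield L)) L (IsCMField.complexConj L) 2).quotFun φ x‖ₑ + ‖((supHeight (↥(maximalRealSubfield L)) L (IsCMField.complexConj L) 2 x : ℝ) ^ (2 * k) : ℂ) * (quasiSplit (↥(maximalRealSubfield L)) L (IsCMField.complexConj L) 2).quotFun φ x‖ₑ) ∂μ := lintegral_mono hpt
    _ = ENNReal.ofReal (‖φ₀‖ * C) * ((∫⁻ x, ‖(quasiSplit (↥(maximalRealSubfield L)) L (IsCMField.complexConj L) 2).quotFun φ x‖ₑ ∂μ) + ∫⁻ x, ‖((supHeight (↥(maximalRealSubfield L)) L (IsCMField.complexConj L) 2 x : ℝ) ^ (2 * k) : ℂ) * (quasiSplit (↥(maximalRealSubfield L)) L (IsCMField.complexConj L) 2).quotFun φ x‖ₑ ∂μ) := by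
        rw [lintegral_const_mul' _ _ ENNReal.ofReal_ne_top, lintegral_add_left' hφ2.1.enorm]
    _ < ∞ := ENNReal.mul_lt_top ENNReal.ofReal_lt_top (ENNReal.add_lt_top.2 ⟨hI1, hI2⟩)

/-- **⟪[w₁^{2k}φ̃], [Ẽ_z]⟫_{𝓗_k(𝔛)} = 0 FOR `φ ∈ 𝒞_k` BOREL** (`1 < Re z ≤ k`): the weighted inner product `∫ conj(w₁^{2k}φ̃)·Ẽ_z·w₁^{−2k} dμ = ∫ Ẽ_z·conj φ̃ dμ` vanishes by ★ «E ⊥ 𝒞_k»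
`…_of_mem_cuspTestClass_cm_two` (its letter `hX` discharged above; `f_z` is Borel, left-`N(𝔸)`- and left-`B(F)`-invariant). The element `s` is ANY class a.e. equal to `w₁^{2k}·φ̃`.
[cite: BernsteinLapid2019, §4 Claim 2 p. 9] [cite: MoeglinWaldspurger1995, II.1.7] -/
theorem inner_toHX_eisensteinSeriesU_eq_zero_cm_two {δ : L} (hcδ : IsCMField.complexConj L δ = -δ) (hδ : δ ≠ 0)
    (μ : Measure (quasiSplit (↥(maximalRealSubfield L)) L (IsCMField.complexConj L) 2).automorphicQuotient) [(quasiSplit (↥(maximalRealSubfield L)) L (IsCMField.complexConj L) 2).IsAutomorphicMeasure μ]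
    (νG : Measure (quasiSplit (↥(maximalRealSubfield L)) L (IsCMField.complexConj L) 2).Adelic) [νG.IsHaarMeasure] [νG.IsInvInvariant]
    (ν : Measure ↥(adelicUnipotent (↥(maximalRealSubfield L)) L (IsCMField.complexConj L) 2)) [ν.IsHaarMeasure] [ν.IsInvInvariant]
    {𝓕 : Set ↥(adelicUnipotent (↥(maximalRealSubfield L)) L (IsCMField.complexConj L) 2)}
    (h𝓕N : IsFundamentalDomain ↥(rationalUnipotent (↥(maximalRealSubfield L)) L (IsCMField.complexConj L) 2) 𝓕 ν) (h𝓕c : IsCompact (closure 𝓕)) (φ₀ : ℂ) {z : ℂ} (hz : 1 < z.re) {k : ℕ} (hzk : z.re ≤ k) (hE : MemLp ((quasiSplit (↥(maximalRealSubfield L)) L (IsCMField.complexConj L) 2).quotFun (eisensteinSeriesU (flatSectionU (fun _ : (quasiSplit (↥(maximalRealSubfield L)) L (IsCMField.complexConj L) 2).Adelic => φ₀) z))) 2 (μ.withDensity fun x => (((supHeight (↥(maximalRealSubfield L)) L (IsCMField.complexConj L) 2 x)⁻¹ ^ (2 * k) : ℝ≥0) : ℝ≥0∞)))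
    {φ : (quasiSplit (↥(maximalRealSubfield L)) L (IsCMField.complexConj L) 2).Adelic → ℂ} (hφ : φ ∈ cuspTestClass (↥(maximalRealSubfield L)) L (IsCMField.complexConj L) 2 k ν 𝓕 μ) (hφm : Measurable φ)
    (s : HX (↥(maximalRealSubfield L)) L (IsCMField.complexConj L) 2 k μ) (hs : (s : (quasiSplit (↥(maximalRealSubfield L)) L (IsCMField.complexConj L) 2).automorphicQuotient → ℂ) =ᵐ[μ.withDensity fun x => (((supHeight (↥(maximalRealSubfield L)) L (IsCMField.complexConj L) 2 x)⁻¹ ^ (2 * k) : ℝ≥0) : ℝ≥0∞)] fun x => ((supHeight (↥(maximalRealSubfield L)) L (IsCMField.complexConj L) 2 x : ℝ) ^ (2 * k) : ℂ) * (quasiSplit (↥(maximalRealSubfield L)) L (IsCMField.complexConj L) 2).quotFun φ x) :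
    inner ℂ s (toHX (↥(maximalRealSubfield L)) L (IsCMField.complexConj L) 2 k μ (eisensteinSeriesU (flatSectionU (fun _ : (quasiSplit (↥(maximalRealSubfield L)) L (IsCMField.complexConj L) 2).Adelic => φ₀) z)) hE) = 0 := by
  haveI := t2Space_adeleRing_of_numberField L
  haveI := locallyCompactSpace_adeleRing' L
  haveI : T2Space (quasiSplit (↥(maximalRealSubfield L)) L (IsCMField.complexConj L) 2).Adelic := inferInstanceAs (T2Space (adelic (↥(maximalRealSubfield L)) L (IsCMField.complexConj L) 2 ((StdForm.antidiagonal 2).over L)))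
  have h𝓕₀ : ν 𝓕 ≠ 0 := measure_ne_zero_of_isFundamentalDomain_rationalUnipotent ν h𝓕N
  have h𝓕top : ν 𝓕 ≠ ∞ := ((measure_mono subset_closure).trans_lt h𝓕c.measure_lt_top).ne
  obtain ⟨c₀, hc₀, hwc⟩ := exists_pos_forall_le_supHeight_cm L
  -- the letters of ★ «E ⊥ 𝒞_k» for `f = f_z`
  have hfm : Measurable (flatSectionU (fun _ : (quasiSplit (↥(maximalRealSubfield L)) L (IsCMField.complexConj L) 2).Adelic => φ₀) z) := (continuous_flatSectionU continuous_const z).measurable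
  have hfN : ∀ (u : ↥(adelicUnipotent (↥(maximalRealSubfield L)) L (IsCMField.complexConj L) 2)) (g : (quasiSplit (↥(maximalRealSubfield L)) L (IsCMField.complexConj L) 2).Adelic), (flatSectionU (fun _ : (quasiSplit (↥(maximalRealSubfield L)) L (IsCMField.complexConj L) 2).Adelic => φ₀) z) ((u : (quasiSplit (↥(maximalRealSubfield L)) L (IsCMField.complexConj L) 2).Adelic) * g) = (flatSectionU (fun _ : (quasiSplit (↥(maximalRealSubfield L)) L (IsCMField.complexConj L) 2).Adelic => φ₀) z) g := fun u g => by
    simp only [flatSectionU_apply, borelHeight_unipotent_mul u.2]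
  have hfB : ∀ b ∈ arithmeticBorel (↥(maximalRealSubfield L)) L (IsCMField.complexConj L) 2, ∀ x : (quasiSplit (↥(maximalRealSubfield L)) L (IsCMField.complexConj L) 2).Adelic, (flatSectionU (fun _ : (quasiSplit (↥(maximalRealSubfield L)) L (IsCMField.complexConj L) 2).Adelic => φ₀) z) ((b : (quasiSplit (↥(maximalRealSubfield L)) L (IsCMField.complexConj L) 2).Adelic) * x) = (flatSectionU (fun _ : (quasiSplit (↥(maximalRealSubfield L)) L (IsCMField.complexConj L) 2).Adelic => φ₀) z) x := fun b hb x => by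
    simp only [flatSectionU_apply, borelHeight_arithmeticBorel_mul' hb x]
  have hX := lintegral_tsum_enorm_flatSectionU_mul_enorm_lt_top_cm_two L hcδ hδ ν h𝓕N h𝓕c μ φ₀ hz hzk hφ.2.2.1 hφ.2.2.2
  have h0 := integral_quotFun_eisensteinSeriesU_mul_conj_eq_zero_of_mem_cuspTestClass_cm_two L μ νG ν h𝓕N h𝓕₀ h𝓕top hfm hfN hfB hφ hφm hX
  -- the weighted inner product, unfolded to `μ`
  have hEco : ((toHX (↥(maximalRealSubfield L)) L (IsCMField.complexConj L) 2 k μ (eisensteinSeriesU (flatSectionU (fun _ : (quasiSplit (↥(maximalRealSubfield L)) L (IsCMField.complexConj L) 2).Adelic => φ₀) z)) hE : HX (↥(maximalRealSubfield L)) L (IsCMField.complexConj L) 2 k μ) : (quasiSplit (↥(maximalRealSubfield L)) L (IsCMField.complexConj L) 2).automorphicQuotient → ℂ) =ᵐ[μ.withDensity fun x => (((supHeight (↥(maximalRealSubfield L)) L (IsCMField.complexConj L) 2 x)⁻¹ ^ (2 * k) : ℝ≥0) : ℝ≥0∞)] (quasiSplit (↥(maximalRealSubfield L)) L (IsCMField.complexConj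 L) 2).quotFun (eisensteinSeriesU (flatSectionU (fun _ : (quasiSplit (↥(maximalRealSubfield L)) L (IsCMField.complexConj L) 2).Adelic => φ₀) z)) := by
    unfold toHX; exact hE.coeFn_toLp
  have hdm : Measurable fun x : (quasiSplit (↥(maximalRealSubfield L)) L (IsCMField.complexConj L) 2).automorphicQuotient => (supHeight (↥(maximalRealSubfield L)) L (IsCMField.complexConj L) 2 x)⁻¹ ^ (2 * k) := (measurable_supHeight.inv).pow_const _
  rw [L2.inner_def, integral_congr_ae (hs.mp (hEco.mono fun x h1 h2 => by rw [h1, h2])), integral_withDensity_eq_integral_smul hdm]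
  rw [← h0]
  refine integral_congr_ae (Eventually.of_forall fun x => ?_)
  have hw0 : ((supHeight (↥(maximalRealSubfield L)) L (IsCMField.complexConj L) 2 x : ℝ) : ℂ) ≠ 0 := by
    have : (0 : ℝ) < (supHeight (↥(maximalRealSubfield L)) L (IsCMField.complexConj L) 2 x : ℝ) := lt_of_lt_of_le (by exact_mod_cast hc₀) (by exact_mod_cast hwc x)
    exact_mod_cast this.ne'
  dsimp only
  rw [RCLike.inner_apply, NNReal.smul_def, Complex.real_smul, map_mul, map_pow, Complex.conj_ofReal]
  push_cast
  have h1 : ((supHeight (↥(maximalRealSubfield L)) L (IsCMField.complexConj L) 2 x : ℝ) : ℂ)⁻¹ ^ (2 * k) * ((supHeight (↥(maximalRealSubfield L)) L (IsCMField.complexConj L) 2 x : ℝ) : ℂ) ^ (2 * k) = 1 := by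
    rw [← mul_pow, inv_mul_cancel₀ hw0, one_pow]
  linear_combination (((quasiSplit (↥(maximalRealSubfield L)) L (IsCMField.complexConj L) 2).quotFun (eisensteinSeriesU (flatSectionU (fun _ : (quasiSplit (↥(maximalRealSubfield L)) L (IsCMField.complexConj L) 2).Adelic => φ₀) z)) x) * (starRingEnd ℂ) ((quasiSplit (↥(maximalRealSubfield L)) L (IsCMField.complexConj L) 2).quotFun φ x)) * h1

/-- **(S3) `Q [Ẽ_z] = 0`.**  On `U(1,1)_{L/L⁺}`, for `1 < Re z ≤ k` and ANY set `𝒮 ⊆ 𝓗_k(𝔛)` of classes a.e. equal to `w₁^{2k}·φ̃` with `φ ∈ 𝒞_k` Borel, the orthogonal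
projection `Q` onto the closed span of `𝒮` kills `[Ẽ_z] = toHX k μ E_z`: `Q (toHX k μ E_z hE) = 0` (the inner products vanish, §3). This is the third equation of the
𝔛-system of ★ G-c `exists_xSystem`. [cite: BernsteinLapid2019, §4 Claim 2 p. 9, §7] -/
theorem starProjection_toHX_eisensteinSeriesU_eq_zero_cm_two {δ : L} (hcδ : IsCMField.complexConj L δ = -δ) (hδ : δ ≠ 0)
    (μ : Measure (quasiSplit (↥(maximalRealSubfield L)) L (IsCMField.complexConj L) 2).automorphicQuotient) [(quasiSplit (↥(maximalRealSubfield L)) L (IsCMField.complexConj L) 2).IsAutomorphicMeasure μ]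
    (νG : Measure (quasiSplit (↥(maximalRealSubfield L)) L (IsCMField.complexConj L) 2).Adelic) [νG.IsHaarMeasure] [νG.IsInvInvariant]
    (ν : Measure ↥(adelicUnipotent (↥(maximalRealSubfield L)) L (IsCMField.complexConj L) 2)) [ν.IsHaarMeasure] [ν.IsInvInvariant]
    {𝓕 : Set ↥(adelicUnipotent (↥(maximalRealSubfield L)) L (IsCMField.complexConj L) 2)}
    (h𝓕N : IsFundamentalDomain ↥(rationalUnipotent (↥(maximalRealSubfield L)) L (IsCMField.complexConj L) 2) 𝓕 ν) (h𝓕c : IsCompact (closure 𝓕)) (φ₀ : ℂ) {z : ℂ} (hz : 1 < z.re) {k : ℕ} (hzk : z.re ≤ k) (hE : MemLp ((quasiSplit (↥(maximalRealSubfield L)) L (IsCMField.complexConj L) 2).quotFun (eisensteinSeriesU (flatSectionU (fun _ : (quasiSplit (↥(maximalRealSubfield L)) L (IsCMField.complexConj L) 2).Adelic => φ₀) z))) 2 (μ.withDensity fun x => (((supHeight (↥(maximalRealSubfield L)) L (IsCMField.complexConj L) 2 x)⁻¹ ^ (2 * k) : ℝ≥0) : ℝ≥0∞)))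
    {𝒮 : Set (HX (↥(maximalRealSubfield L)) L (IsCMField.complexConj L) 2 k μ)}
    (h𝒮 : ∀ s ∈ 𝒮, ∃ φ ∈ cuspTestClass (↥(maximalRealSubfield L)) L (IsCMField.complexConj L) 2 k ν 𝓕 μ, Measurable φ ∧
      (s : (quasiSplit (↥(maximalRealSubfield L)) L (IsCMField.complexConj L) 2).automorphicQuotient → ℂ) =ᵐ[μ.withDensity fun x => (((supHeight (↥(maximalRealSubfield L)) L (IsCMField.complexConj L) 2 x)⁻¹ ^ (2 * k) : ℝ≥0) : ℝ≥0∞)] fun x => ((supHeight (↥(maximalRealSubfield L)) L (IsCMField.complexConj L) 2 x : ℝ) ^ (2 * k) : ℂ) * (quasiSplit (↥(maximalRealSubfield L)) L (IsCMField.complexConj L) 2).quotFun φ x) :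
    (Submodule.span ℂ 𝒮).topologicalClosure.starProjection (toHX (↥(maximalRealSubfield L)) L (IsCMField.complexConj L) 2 k μ (eisensteinSeriesU (flatSectionU (fun _ : (quasiSplit (↥(maximalRealSubfield L)) L (IsCMField.complexConj L) 2).Adelic => φ₀) z)) hE) = 0 := by
  refine starProjection_topologicalClosure_span_eq_zero fun s hs => ?_
  obtain ⟨φ, hφ, hφm, hsφ⟩ := h𝒮 s hs
  exact inner_toHX_eisensteinSeriesU_eq_zero_cm_two L hcδ hδ μ νG ν h𝓕N h𝓕c φ₀ hz hzk hE hφ hφm s hsφ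

end CuspOrthogonal

end Summit.HodgeConjecture.HodgeConjecture.Cruxes.H413.K2E1SphericalEisensteinSolvesXSystemU2
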